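import Summits.Ventures.PercRepro.CatDefs

/-!
# Branch catalogues — within-part notions are local (module 2)

For the gadget of a catalogue, the within-part open adjacency, connectivity, H-step and H-walks of
the branch `b` (`OpenAdjIn`, `ConnIn` of `ConnJoin`; `HAdjIn`, `HConnAvoidIn` of `HJoin`) are the
corresponding notions of the LOCAL graph `loc b.1` in the branch state `brState S b`, transported
along the embedding `emb b` — provided the global cluster of `c` (which `HAdjIn` mentions) is read
locally, which is `mem_cluster_vm_iff_loc` (Lemma 2 of the profile theorem, `conn_mark_iff_parts`).
-/

namespace PercRepro.CatGraph

open MultiGraph StarGadgetGraph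

variable {C : Type} {BV BE : C → Type} {m : C → ℕ}

/-- `emb b` is injective. -/
theorem emb_injective (b : Br m) : Function.Injective (emb (BV := BV) b) := by
  intro u v h
  cases u <;> cases v <;> simp [emb] at h <;> simp [h]

/-- A branch vertex of `b` is in the range of `emb b`; a vertex in the range of `emb b` is a terminal
or a vertex of `b`. -/
theorem mem_range_emb_iff (b : Br m) (w : CV BV m) :
    w ∈ Set.range (emb b) ↔ w ∈ Cen BV m ∨ ∃ v, w = emb b (.inr v) := by
  constructor
  · rintro ⟨u, rfl⟩
    cases u with
    | inl i => exact Or.inl (cen_mem_cen i)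
    | inr v => exact Or.inr ⟨v, rfl⟩
  · rintro (⟨i, rfl⟩ | ⟨v, rfl⟩)
    · exact ⟨.inl i, rfl⟩
    · exact ⟨.inr v, rfl⟩

/-- Pulling back a closure along an injection when every NON-TRIVIAL related pair lies in the range. -/
theorem reflTransGen_comap_iff' {α β : Type*} (f : α → β) (hf : Function.Injective f)
    (r : β → β → Prop) (hr : ∀ x y, r x y → x ≠ y → x ∈ Set.range f ∧ y ∈ Set.range f)
    (i j : α) :
    Relation.ReflTransGen r (f i) (f j) ↔
      Relation.ReflTransGen (fun i j => r (f i) (f j)) i j := by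
  constructor
  · intro h
    have key : ∀ {w}, Relation.ReflTransGen r (f i) w →
        ∃ j', w = f j' ∧ Relation.ReflTransGen (fun i j => r (f i) (f j)) i j' := by
      intro w hw
      induction hw with
      | refl => exact ⟨i, rfl, Relation.ReflTransGen.refl⟩
      | @tail x y _ hxy ih =>
        obtain ⟨j', rfl, hj'⟩ := ih
        by_cases hxy' : f j' = y
        · exact ⟨j', hxy'.symm, hj'⟩
        · obtain ⟨-, ⟨j'', rfl⟩⟩ := hr _ _ hxy hxy'
          exact ⟨j'', rfl, hj'.tail hxy⟩
    obtain ⟨j', hj, hR⟩ := key h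
    obtain rfl := hf hj
    exact hR
  · intro h
    exact h.lift f (fun _ _ hxy => hxy)

section Parts

variable (loc : ∀ τ, MultiGraph (Fin 4 ⊕ BV τ) (BE τ))

/-- The edges of the part `some b` are the edges of the branch `b`. -/
theorem pe_eq_some_iff (e : CE BE m) (b : Br m) : pe e = some b ↔ e.1 = b := by
  simp [pe]

/-- `Joins` of a branch edge, read locally. -/
theorem joins_iff_loc (b : Br m) (e : BE b.1) (u v : Fin 4 ⊕ BV b.1) :
    (catGadget loc m).Joins ⟨b, e⟩ (emb b u) (emb b v) ↔ (loc b.1).Joins e u v := by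
  unfold Joins
  show (emb b ((loc b.1).fst e) = emb b u ∧ emb b ((loc b.1).snd e) = emb b v) ∨
    (emb b ((loc b.1).fst e) = emb b v ∧ emb b ((loc b.1).snd e) = emb b u) ↔ _
  simp only [(emb_injective b).eq_iff]

/-- Within-part open adjacency of the branch `b` is the local open adjacency. -/
theorem openAdjIn_iff_loc (S : Config (CE BE m)) (b : Br m) (u v : Fin 4 ⊕ BV b.1) :
    (catGadget loc m).OpenAdjIn S pe (some b) (emb b u) (emb b v) ↔
      (loc b.1).OpenAdj (brState S b) u v := by
  unfold OpenAdjIn OpenAdj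
  constructor
  · rintro ⟨⟨b', e⟩, hb, he, hj⟩
    rw [pe_eq_some_iff] at hb
    subst hb
    exact ⟨e, he, (joins_iff_loc loc b' e u v).1 hj⟩
  · rintro ⟨e, he, hj⟩
    exact ⟨⟨b, e⟩, rfl, he, (joins_iff_loc loc b e u v).2 hj⟩

/-- A non-trivial within-part open step of the branch `b` has both ends in the range of `emb b`. -/
theorem openAdjIn_mem_range (S : Config (CE BE m)) (b : Br m) {x y : CV BV m}
    (h : (catGadget loc m).OpenAdjIn S pe (some b) x y) :
    x ∈ Set.range (emb b) ∧ y ∈ Set.range (emb b) := by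
  obtain ⟨⟨b', e⟩, hb, -, hj⟩ := h
  rw [pe_eq_some_iff] at hb
  subst hb
  rcases hj with ⟨h1, h2⟩ | ⟨h1, h2⟩
  · exact ⟨⟨_, h1⟩, ⟨_, h2⟩⟩
  · exact ⟨⟨_, h2⟩, ⟨_, h1⟩⟩

/-- Within-part connectivity of the branch `b` is the local connectivity. -/
theorem connIn_iff_loc (S : Config (CE BE m)) (b : Br m) (u v : Fin 4 ⊕ BV b.1) :
    (catGadget loc m).ConnIn S pe (some b) (emb b u) (emb b v) ↔
      (loc b.1).Conn (brState S b) u v := by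
  unfold ConnIn Conn
  rw [reflTransGen_comap_iff' (emb b) (emb_injective b) _
    (fun x y hxy _ => openAdjIn_mem_range loc S b hxy)]
  constructor
  · intro h
    induction h with
    | refl => exact Relation.ReflTransGen.refl
    | tail _ hxy ih => exact ih.tail ((openAdjIn_iff_loc loc S b _ _).1 hxy)
  · intro h
    induction h with
    | refl => exact Relation.ReflTransGen.refl
    | tail _ hxy ih => exact ih.tail ((openAdjIn_iff_loc loc S b _ _).2 hxy)

/-- Nothing is connected through the part `none`. -/
theorem connIn_none_iff (S : Config (CE BE m)) (u v : CV BV m) :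
    (catGadget loc m).ConnIn S pe none u v ↔ u = v := by
  unfold ConnIn
  constructor
  · intro h
    induction h with
    | refl => rfl
    | tail _ hxy ih =>
      obtain ⟨e, he, -⟩ := hxy
      cases he
  · rintro rfl
    exact Relation.ReflTransGen.refl

/-- A within-part walk of the branch `b'` ending at a vertex of the branch `b` is a walk of `b`
(or trivial): the branches coincide. -/
theorem eq_of_connIn_emb (S : Config (CE BE m)) {b' : Br m} {b : Br m} {u : CV BV m} {v : BV b.1}
    (h : (catGadget loc m).ConnIn S pe (some b') u (emb b (.inr v))) (hne : u ≠ emb b (.inr v)) :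
    b' = b := by
  unfold ConnIn at h
  have key : ∀ {w}, Relation.ReflTransGen ((catGadget loc m).OpenAdjIn S pe (some b')) u w →
      w = u ∨ w ∈ Set.range (emb b') := by
    intro w hw
    induction hw with
    | refl => exact Or.inl rfl
    | tail _ hxy _ => exact Or.inr (openAdjIn_mem_range loc S b' hxy).2
  rcases key h with h1 | ⟨w, hw⟩
  · exact absurd h1.symm hne
  · cases w with
    | inl i => cases hw
    | inr v' =>
      have := Sum.inr.inj hw
      exact (Sigma.mk.inj_iff.1 this).1


/-! ### Modes and the clusters, read locally (Lemma 2) -/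

/-- The centre attaches to the mark `m'` through some branch. -/
def AttG (S : Config (CE BE m)) (m' : Fin 3) : Prop := ∃ b : Br m, attTo loc b.1 (brState S b) m'

/-- A configuration is in mode `μ`: `bot`, and the centre attaches exactly to the mark of `μ`. -/
def InMode (μ : Mode) (S : Config (CE BE m)) : Prop :=
  (catGadget loc m).IsBot S (vm 0) (vm 1) (vm 2) ∧ ∀ m', AttG loc S m' ↔ μ = some m'

/-- `vm` is injective. -/
theorem vm_inj {m₁ m₂ : Fin 3} : (vm m₁ : CV BV m) = vm m₂ ↔ m₁ = m₂ := by
  simp [vm, Fin.castSucc_inj]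

/-- A mark is not the centre. -/
theorem vm_ne_vx (m' : Fin 3) : (vm m' : CV BV m) ≠ vx := by
  simp only [vm, vx, ne_eq, Sum.inl.injEq]
  fin_cases m' <;> decide

/-- In a bot configuration two distinct marks are disconnected. -/
theorem not_conn_vm_of_isBot {S : Config (CE BE m)}
    (hb : (catGadget loc m).IsBot S (vm 0) (vm 1) (vm 2)) (m₁ m₂ : Fin 3) (hne : m₁ ≠ m₂) :
    ¬ (catGadget loc m).Conn S (vm m₁) (vm m₂) := by
  obtain ⟨h01, h02, h12⟩ := hb
  have h10 : ¬ (catGadget loc m).Conn S (vm 1) (vm 0) := fun h => h01 h.symm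
  have h20 : ¬ (catGadget loc m).Conn S (vm 2) (vm 0) := fun h => h02 h.symm
  have h21 : ¬ (catGadget loc m).Conn S (vm 2) (vm 1) := fun h => h12 h.symm
  fin_cases m₁ <;> fin_cases m₂ <;> simp_all

/-- The within-part attachment of the branch `b` to the mark `m'`, read globally. -/
theorem connIn_vm_vx_iff (S : Config (CE BE m)) (b : Br m) (m' : Fin 3) :
    (catGadget loc m).ConnIn S pe (some b) (vm m') vx ↔ attTo loc b.1 (brState S b) m' :=
  connIn_iff_loc loc S b (.inl m'.castSucc) (.inl 3)

/-- A terminal is connected to the centre through some part iff the centre attaches to it. -/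
theorem exists_connIn_vm_vx_iff (S : Config (CE BE m)) (m' : Fin 3) :
    (∃ i, (catGadget loc m).ConnIn S pe i (vm m') vx) ↔ AttG loc S m' := by
  constructor
  · rintro ⟨i, hi⟩
    rcases i with _ | b
    · exact absurd ((connIn_none_iff loc S _ _).1 hi) (vm_ne_vx m')
    · exact ⟨b, (connIn_vm_vx_iff loc S b m').1 hi⟩
  · rintro ⟨b, hb⟩
    exact ⟨some b, (connIn_vm_vx_iff loc S b m').2 hb⟩

/-- **Lemma 2, instantiated**: in a bot configuration, a vertex lies in the cluster of the mark
`m'` iff some part connects it to `m'`, or the centre attaches to `m'` and some part connects the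
centre to it. -/
theorem conn_vm_iff_parts {S : Config (CE BE m)}
    (hb : (catGadget loc m).IsBot S (vm 0) (vm 1) (vm 2)) (m' : Fin 3) (w : CV BV m) :
    (catGadget loc m).Conn S (vm m') w ↔
      (∃ i, (catGadget loc m).ConnIn S pe i (vm m') w) ∨
        (AttG loc S m' ∧ ∃ j, (catGadget loc m).ConnIn S pe j vx w) := by
  have hMk : ({vm 0, vm 1, vm 2} : Set (CV BV m)) ⊆ Cen BV m := by
    intro t ht
    simp only [Set.mem_insert_iff, Set.mem_singleton_iff] at ht
    rcases ht with rfl | rfl | rfl <;> exact ⟨_, rfl⟩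
  have hxM : (vx : CV BV m) ∉ ({vm 0, vm 1, vm 2} : Set (CV BV m)) := by
    simp only [Set.mem_insert_iff, Set.mem_singleton_iff, not_or]
    exact ⟨(vm_ne_vx 0).symm, (vm_ne_vx 1).symm, (vm_ne_vx 2).symm⟩
  have hCen : ∀ t ∈ Cen BV m, t ∈ ({vm 0, vm 1, vm 2} : Set (CV BV m)) ∨ t = vx := by
    intro t ht
    rcases cen_cases' t ht with rfl | rfl | rfl | rfl
    · exact Or.inl (by simp [vm, cen])
    · exact Or.inl (by simp [vm, cen])
    · exact Or.inl (by simp [vm, cen])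
    · exact Or.inr rfl
  have hmem : ∀ t ∈ ({vm 0, vm 1, vm 2} : Set (CV BV m)), ∃ m'' : Fin 3, t = vm m'' := by
    intro t ht
    simp only [Set.mem_insert_iff, Set.mem_singleton_iff] at ht
    rcases ht with rfl | rfl | rfl
    · exact ⟨0, rfl⟩
    · exact ⟨1, rfl⟩
    · exact ⟨2, rfl⟩
  have hbot : ∀ i, ∀ t ∈ ({vm 0, vm 1, vm 2} : Set (CV BV m)),
      ∀ t' ∈ ({vm 0, vm 1, vm 2} : Set (CV BV m)), t ≠ t' → ¬ (catGadget loc m).ConnIn S pe i t t' := by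
    intro i t ht t' ht' hne hc
    obtain ⟨m₁, rfl⟩ := hmem t ht
    obtain ⟨m₂, rfl⟩ := hmem t' ht'
    exact not_conn_vm_of_isBot loc hb m₁ m₂ (fun h => hne (by rw [h])) hc.conn
  have hmode : ∀ i j, ∀ t ∈ ({vm 0, vm 1, vm 2} : Set (CV BV m)),
      ∀ t' ∈ ({vm 0, vm 1, vm 2} : Set (CV BV m)), t ≠ t' →
      (catGadget loc m).ConnIn S pe i t vx → (catGadget loc m).ConnIn S pe j t' vx → False := by
    intro i j t ht t' ht' hne h1 h2
    obtain ⟨m₁, rfl⟩ := hmem t ht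
    obtain ⟨m₂, rfl⟩ := hmem t' ht'
    exact not_conn_vm_of_isBot loc hb m₁ m₂ (fun h => hne (by rw [h])) (h1.conn.trans h2.conn.symm)
  have hm' : (vm m' : CV BV m) ∈ ({vm 0, vm 1, vm 2} : Set (CV BV m)) := by
    fin_cases m' <;> simp
  rw [(catGadget loc m).conn_mark_iff_parts S (Cen BV m) {vm 0, vm 1, vm 2} vx pe br (hpart loc m)
    hMk hxM hCen hbot hmode hm' w]
  constructor
  · rintro (h | ⟨i, j, h1, h2⟩)
    · exact Or.inl h
    · exact Or.inr ⟨(exists_connIn_vm_vx_iff loc S m').1 ⟨i, h1⟩, j, h2⟩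
  · rintro (h | ⟨hA, j, h2⟩)
    · exact Or.inl h
    · obtain ⟨i, h1⟩ := (exists_connIn_vm_vx_iff loc S m').2 hA
      exact Or.inr ⟨i, j, h1, h2⟩

/-- In mode `μ`, no part connects two distinct marks (local bot of every branch). -/
theorem localBot_of_inMode {μ : Mode} {S : Config (CE BE m)} (hμ : InMode loc μ S) (b : Br m) :
    localBot loc b.1 (brState S b) := by
  intro i j hne hc
  exact not_conn_vm_of_isBot loc hμ.1 i j hne
    ((connIn_iff_loc loc S b (.inl i.castSucc) (.inl j.castSucc)).2 hc).conn

/-- In mode `μ`, a branch attaching the mark `m'` forces `μ = some m'`. -/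
theorem eq_some_of_attTo {μ : Mode} {S : Config (CE BE m)} (hμ : InMode loc μ S) {b : Br m}
    {m' : Fin 3} (h : attTo loc b.1 (brState S b) m') : μ = some m' :=
  (hμ.2 m').1 ⟨b, h⟩

/-- **The clusters of the marks, read locally**: in mode `μ`, a local vertex of the branch `b` lies
in the cluster of the mark `m'` iff `inClLoc`. -/
theorem mem_cluster_vm_iff_loc {μ : Mode} {S : Config (CE BE m)} (hμ : InMode loc μ S) (m' : Fin 3)
    (b : Br m) (v : Fin 4 ⊕ BV b.1) :
    emb b v ∈ (catGadget loc m).cluster S (vm m') ↔ inClLoc loc μ b.1 m' (brState S b) v := by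
  rw [mem_cluster, conn_vm_iff_parts loc hμ.1 m']
  unfold inClLoc
  cases v with
  | inr v' =>
    constructor
    · rintro (⟨i, hi⟩ | ⟨hA, j, hj⟩)
      · rcases i with _ | b'
        · exact absurd ((connIn_none_iff loc S _ _).1 hi) Sum.inl_ne_inr
        · obtain rfl := eq_of_connIn_emb loc S hi Sum.inl_ne_inr
          exact Or.inl ((connIn_iff_loc loc S b' (.inl m'.castSucc) (.inr v')).1 hi)
      · rcases j with _ | b'
        · exact absurd ((connIn_none_iff loc S _ _).1 hj) Sum.inl_ne_inr
        · obtain rfl := eq_of_connIn_emb loc S hj Sum.inl_ne_inr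
          exact Or.inr ⟨(hμ.2 m').1 hA, (connIn_iff_loc loc S b' (.inl 3) (.inr v')).1 hj⟩
    · rintro (h | ⟨hm, h⟩)
      · exact Or.inl ⟨some b, (connIn_iff_loc loc S b (.inl m'.castSucc) (.inr v')).2 h⟩
      · exact Or.inr ⟨(hμ.2 m').2 hm, some b, (connIn_iff_loc loc S b (.inl 3) (.inr v')).2 h⟩
  | inl k =>
    rw [emb_inl]
    rcases Fin.eq_castSucc_or_eq_last k with ⟨k', rfl⟩ | rfl
    · -- a mark
      by_cases hk : k' = m'
      · subst hk
        constructor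
        · intro _; exact Or.inl (Conn.refl _ _ _)
        · intro _; exact Or.inl ⟨none, (connIn_none_iff loc S _ _).2 rfl⟩
      · constructor
        · rintro (⟨i, hi⟩ | ⟨hA, j, hj⟩)
          · exact absurd hi.conn (not_conn_vm_of_isBot loc hμ.1 m' k' (Ne.symm hk))
          · have hA' : AttG loc S k' := by
              rcases j with _ | b'
              · exact absurd ((connIn_none_iff loc S _ _).1 hj) (vm_ne_vx k').symm
              · exact ⟨b', (connIn_vm_vx_iff loc S b' k').1 (connIn_symm hj)⟩
            have e1 := (hμ.2 m').1 hA
            have e2 := (hμ.2 k').1 hA'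
            exact absurd (Option.some.inj (e2.symm.trans e1)) hk
        · rintro (h | ⟨hm, h⟩)
          · exact absurd ((connIn_iff_loc loc S b _ _).2 h).conn
              (not_conn_vm_of_isBot loc hμ.1 m' k' (Ne.symm hk))
          · have hA' : AttG loc S k' :=
              ⟨b, (connIn_vm_vx_iff loc S b k').1 (connIn_symm ((connIn_iff_loc loc S b _ _).2 h))⟩
            have e2 := (hμ.2 k').1 hA'
            exact absurd (Option.some.inj (e2.symm.trans hm)) hk
    · -- the centre
      constructor
      · rintro (⟨i, hi⟩ | ⟨hA, -⟩)
        · have hA : AttG loc S m' := (exists_connIn_vm_vx_iff loc S m').1 ⟨i, hi⟩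
          exact Or.inr ⟨(hμ.2 m').1 hA, Conn.refl _ _ _⟩
        · exact Or.inr ⟨(hμ.2 m').1 hA, Conn.refl _ _ _⟩
      · rintro (h | ⟨hm, -⟩)
        · exact Or.inl ⟨some b, (connIn_iff_loc loc S b _ _).2 h⟩
        · obtain ⟨b', hb'⟩ := (hμ.2 m').2 hm
          exact Or.inl ⟨some b', (connIn_vm_vx_iff loc S b' m').2 hb'⟩

end Parts

end PercRepro.CatGraph
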